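import Summits.Ventures.DiscreteObjects.Hadamard.ConferenceGraph333InvolutionBound149
import Summits.Ventures.DiscreteObjects.Hadamard.ConferenceGraph333OrderCensusA

/-!
# Automorphisms of order `82` of srg(333,166,82,83) have the single cycle type `82⁴·2²·1¹` (kernel)

Framing: lottery ticket; floor = certified bounds/negative ranges.  Cell pub-namedobj (venture DiscreteObjects),
target (H) = `H(668)`, hadamard gen 31.  First census consequence of the gen-31 involution bound `f ≤ 149`
(`ConferenceGraph333InvolutionBound149`): with the cycle-length census kit (`ConferenceGraph333CycleParity.aut_cycle_length_census`:
`c_L = #{x : period L}`, `Σ c_L = 333`, fixed points of powers, `2L ∣ c_L`, orbit bound), the order-`41` window `#Fix = 5` for `σ²`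
and the involution window for `σ⁴¹`, an automorphism `σ` of order `82` (`σ⁸² = 1`, `σ⁴¹ ≠ 1`, `σ² ≠ 1`) has
`c₄₁ + c₈₂ = 328` with `82 ∣ c₄₁`, `164 ∣ c₈₂`, so `(c₄₁, c₈₂) ∈ {(0,328), (164,164), (328,0)}`; the last two give `#Fix σ⁴¹ = c₁ + c₄₁
≥ 165 > 149` (the type `82²·41⁴·2²·1` with `#Fix σ⁴¹ = 165` was admissible under the gen-29 bound `165`), and `c₈₂ = 328 > 0` forces
`82(c₁ + 1) ≤ 333`, i.e. `c₁ = 1`, `c₂ = 4`: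
* **`aut_order82_cycle_type`** — `#Fix σ = 1`, `#Fix σ² = 5`, `#Fix σ⁴¹ = 1`: the involution `σ⁴¹` fixes exactly ONE vertex, `σ` fixes one
  of the five fixed vertices of the order-`41` element `σ²` and swaps the other four in two `2`-cycles, and the remaining `328` vertices
  form four `82`-cycles (cycle type `82⁴·2²·1¹`; E2: pub-namedobj-hadamard-g31/results/cycle_types_g31.txt, the only admissible type).
WORDS: structure of a HYPOTHETICAL object (no srg(333,166,82,83) / C(334) / H(668) is constructed or excluded; order `82` itself is NOT
excluded); ours (PROVISIONAL).  No `sorry`, no new definitions.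
-/

namespace Summit.Ventures.DiscreteObjects.Hadamard

open Finset

section order82
variable {V : Type*} [Fintype V] [DecidableEq V]

/-- **Order `82`: unique cycle type `82⁴·2²·1¹`** — `#Fix σ = 1`, `#Fix σ² = 5`, `#Fix σ⁴¹ = 1`. -/
theorem aut_order82_cycle_type (hV : Fintype.card V = 333) (A : Matrix V V ℤ)
    (h01 : ∀ x y, A x y = 0 ∨ A x y = 1) (hsymm : ∀ x y, A y x = A x y) (hdiag : ∀ x, A x x = 0)
    (hk : ∀ x, ∑ y, A x y = 166) (hsrg : ∀ x y, ∑ z, A x z * A z y = 83 * (1 + (if x = y then 1 else 0)) - A x y)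
    (σ : Equiv.Perm V) (hσ : σ ^ 82 = 1) (hσ41 : σ ^ 41 ≠ 1) (hσ2 : σ ^ 2 ≠ 1) (hA : ∀ x y, A (σ x) (σ y) = A x y) :
    (univ.filter fun x => σ x = x).card = 1 ∧ (univ.filter fun x => (σ ^ 2) x = x).card = 5 ∧
      (univ.filter fun x => (σ ^ 41) x = x).card = 1 := by
  have hAk := adj_pow_invariant A σ hA
  obtain ⟨c, h1, h2, -, h4, h6⟩ := aut_cycle_length_census hV A h01 hsymm hdiag hk hsrg σ hσ (by norm_num) hA
  have hD : Nat.divisors 82 = {1, 2, 41, 82} := by decide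
  have f1 := h2 1
  have f2 := h2 2
  have f41 := h2 41
  have e2 := h6 2 (by norm_num)
  have e41 := h6 41 (by norm_num)
  have e82 := h6 82 (by norm_num)
  have o82 := h4 82 (by norm_num)
  rw [pow_one] at f1
  simp only [hD, Finset.sum_filter] at h1 f1 f2 f41
  norm_num at h1 f1 f2 f41
  rw [f1] at o82
  -- the involution σ⁴¹: f ≡ 1 (mod 4), f ≤ 149 (gen 31)
  have hp41 : (σ ^ 41) ^ 2 = 1 := by rw [← pow_mul]; exact hσ
  have hinv41 : ∀ x, (σ ^ 41) ((σ ^ 41) x) = x := fun x => by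
    have := congrArg (fun g : Equiv.Perm V => g x) hp41
    simpa [pow_two] using this
  obtain ⟨wm41, wl41⟩ := involution_window_149 hV A h01 hsymm hdiag hk hsrg (σ ^ 41) hinv41 hσ41 (hAk 41)
  rw [f41] at wm41 wl41
  -- the order-41 element σ²: exactly 5 fixed points
  have hp2 : (σ ^ 2) ^ 41 = 1 := by rw [← pow_mul]; exact hσ
  obtain ⟨-, -, -, -, -, -, -, -, w2, -⟩ :=
    aut_prime_windows_refined hV A h01 hsymm hdiag hk hsrg (by norm_num : Nat.Prime 41) (by norm_num) (σ ^ 2) hp2 hσ2 (hAk 2)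
  have hw2 := w2 rfl
  rw [f2] at hw2
  rw [f1, f2, f41]
  clear hAk h2 h4 h6 hD hA hsrg hk hdiag hsymm h01 hσ hp41 hp2 w2 f1 f2 f41
  rcases o82 with o82a | o82b <;> omega

end order82

end Summit.Ventures.DiscreteObjects.Hadamard
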